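import Literature.MathematicalPhysics.QuantumFieldTheory.Balaban1983to89.B11Eq101Translation

/-!
# `Balaban1983to89.B11Eq108Reduction` — T. Bałaban, *The variational problem and background fields in renormalization group method
# for lattice gauge theories*, Commun. Math. Phys. **102** (1985) 277–309 [Balaban1985Variational]: (105)–(111) pp. 293–294 — the
# reduction of the translated variational equation (101)–(102) to Eq. (111) `A₁ + 𝔊J + 𝔊((δ/δA′)V)(A₁ + H₁B) = 0` through the
# projection 𝔓 and the inverse G₁ of Δ₁ + DRD* + aQ*Q, PROVED over the abstract vocabulary of `B11Eq127EulerLagrange` /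
# `B11Eq129Minimizer` / `B11Eq101Translation` (theorem-only)

statement-level skeleton of published theorems with citation tags; proofs where landed; nothing here is a claim about the Yang–Mills mass gap

PDF held: `paper:balaban1985-cmp102-variational-background` (journal page = PDF page + 276); pp. 293–294 (PDF 17–18) read from the held
text by this seat (2026-08-21); the render `…/1985-cmp102-variational-background-p017-x2.png` was read as an image by gen 2 of this seat
(`B11Eq101Translation`), p. 294 by gen 1 (transcript in `HOME/lit-balaban-r08/SKELETON-r08.md`).

CITATION HEADER (lean-in-tree rule 2026-08-18).  WHAT IS REPRODUCED: SKELETON row `B11.Eq105` ((105)–(111)) of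
`HOME/lit-balaban-r08/ROWS-B11.md` (so far: «typed (carrier) + proved (abstract)» = only the fixed-point FORM of (111),
`B11Prop6Scheme.mapT`, and «constraints automatic», `B11Prop6Scheme.solution_mem_submodule`) — here the DERIVATION (105)–(110) and the
sentence on 𝔊.  REUSED by name: `B11Eq127EulerLagrange.laplaceA` (`Δ₁ + DRD* + Q*aQ`), `inner_laplaceA_apply`; the setting of
`B11Eq101Translation` ((101)–(102), whose output is this file's input).  Mega-formalization `lit-balaban`, reader/typer seat r08 gen 6
(unit `lit-balaban-r08`, HOME `run/shared/lean/pub/lit-balaban/`).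

THE PRINT (p. 293 [PDF 17] bottom – p. 294 [PDF 18], verbatim).  «Now we will write equations obtained from (101) by removing the
variations δA′. We have to take into account Eqs. (102) for δA′. By the definition of 𝔓 we obtain all the variations δA′ satisfying
(102), if we take δA′ = 𝔓δA for all variations δA, without any restrictions. We get the equalities
  ⟨𝔓δA, J⟩ = ⟨δA, 𝔓*J⟩, (105)
  ⟨𝔓δA, Δ₁A₁⟩ = ⟨𝔓δA, (Δ₁ + DRD* + aQ*Q)A₁⟩ = ⟨δA, Δ₁A₁⟩, (106)
  ⟨𝔓δA, ((δ/δA′)V)(A₁ + H₁B)⟩ = ⟨δA, 𝔓*((δ/δA′)V)(A₁ + H₁B)⟩. (107)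
Applying them in (101) and using the fact that now δA are arbitrary, we get the equations
  𝔓*J + Δ₁A₁ + 𝔓*((δ/δA′)V)(A₁ + H₁B) = 0, (108)
  QA₁ = 0, RD*A₁ = 0. (109)
They are equivalent to Eqs. (101), (102). We denote by G₁ an inverse operator to the operator Δ₁ + DRD* + aQ*Q. Obviously we have
Δ₁A₁ = G₁⁻¹A₁ and Eq. (108) implies
  A₁ + G₁𝔓*J + G₁𝔓*((δ/δA′)V)(A₁ + H₁B) = 0. (110)
In [5] we have proved that the operator G₁𝔓* is equal to the operator 𝔊 defined by (3.148) and satisfying the equalities Q𝔊 = 0,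
RD*𝔊 = 0. Thus any solution of (110) satisfies automatically Eq. (108), (109). Let us rewrite this equation using the operator 𝔊,
  A₁ + 𝔊J + 𝔊((δ/δA′)V)(A₁ + H₁B) = 0. (111)»
and p. 293: «Let us recall that 𝔓 is an orthogonal projection in a space of configurations A′ with a scalar product defined by the
operator Δ₁ + D*RD + aQ*Q, onto a subspace of A′ satisfying the conditions QA′ = 0, RD*A′ = 0.»

DICTIONARY (the abstract real inner-product spaces `E` (fields A′, A₁, δA), `F` (block data), module `S` (range of D*) of
`B11Eq101Translation`; nothing of the lattice is constructed).  `M := laplaceA Δ₁ D R Dstar Q Qadj a` = Δ₁ + DRD* + Q*aQ; `G₁` with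
`M(G₁x) = x` and `G₁(Mx) = x` («an inverse operator»); the constraint space K = {QA = 0, RD*A = 0} ((102)/(109)); the projection 𝔓 is
HYPOTHESIS-STYLE — any linear `P : E →ₗ E` with range in K (`hPK`), identity on K (`hPid`) and M-symmetric `⟨Px, My⟩ = ⟨x, M(Py)⟩`
(`hPsym`; = orthogonality for the scalar product ⟨x, y⟩_M = ⟨x, My⟩ of p. 293), and `Padj` its ⟨·,·⟩-adjoint `⟨Px, y⟩ = ⟨x, P*y⟩`
(`hPadj`); the functional derivative ((δ/δA′)V)(A₁ + H₁B) enters as a VECTOR `W : E` paired by ⟨δA′, W⟩ (print's notation in (99),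
(107); `B11Eq101Translation` writes the same term as a functional `DV δA′` — `eq101_vector_iff` is the one-line bridge for
`DV = ⟨·, W⟩`); the operator «G₁𝔓*» of (110)/(111) is written `G₁ ∘ₗ Padj` (no definition is introduced).

WHAT IS CERTIFIED (kernel, sorry-free).  `laplaceA_apply_of_mem` («Obviously we have Δ₁A₁ = G₁⁻¹A₁»: MA₁ = Δ₁A₁ on K); **(105)**
`eq105`, **(106)** `eq106`, **(107)** `eq107`; **(108)–(109) from (101)–(102)** `eq108_of_eq101` (δA′ = 𝔓δA, δA arbitrary, then
non-degeneracy of ⟨·,·⟩); the converse `eq101_of_eq108` («They are equivalent to Eqs. (101), (102)», `eq108_iff_eq101`); **(110)**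
`eq110_of_eq108`; the operator identity `frakG_eq_proj_comp` G₁𝔓* = 𝔓G₁ (from 𝔓*M = M𝔓) and hence **«Q𝔊 = 0, RD*𝔊 = 0»**
`frakG_mem` PROVED for 𝔊 = G₁𝔓*; **«any solution of (110) satisfies automatically Eq. (108), (109)»** `eq108_109_of_eq110`; **(111)**
`eq111_iff_eq110` (definitional) and the summary `eq111_iff_eq101` ((111) ⇔ (101) ∧ (102) for the vector form).

HONEST SCOPE — what is NOT claimed.  The EXISTENCE of 𝔓 and of G₁ (positivity of Δ₁ + DRD* + aQ*Q on the lattice — [5] Sect. D,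
Thms 3.12–3.13) and the identification of G₁𝔓* with the FORMULA (3.148) of [5] (`B9.frakP`/`frakPstar`/`frakG_3150` in B9's ring
vocabulary; row `B9.Eq3.148`) are hypotheses/not typed here; the spaces (104), (115) and Proposition 5's transformation (112) are
not this row.  Nothing here is progress on the summit `Summit.QuantumFields`.  Net new unproved facts: 0.
-/

open scoped InnerProductSpace

namespace Literature.MathematicalPhysics.QuantumFieldTheory.Balaban1983to89.B11Eq108Reduction

open B11Eq127EulerLagrange (laplaceA inner_laplaceA_apply)

variable {E F : Type*} [NormedAddCommGroup E] [InnerProductSpace ℝ E] [NormedAddCommGroup F]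
  [InnerProductSpace ℝ F]
variable {S : Type*} [AddCommGroup S] [Module ℝ S]
variable {Δ₁ G₁ P Padj : E →ₗ[ℝ] E} {Q : E →ₗ[ℝ] F} {Qadj : F →ₗ[ℝ] E}
variable {D : S →ₗ[ℝ] E} {R : S →ₗ[ℝ] S} {Dstar : E →ₗ[ℝ] S} {a : ℝ}

/-! ## §1 «Obviously we have Δ₁A₁ = G₁⁻¹A₁» -/

/-- On the constraint space (109) `QA₁ = 0, RD*A₁ = 0` the operator `G₁⁻¹ = Δ₁ + DRD* + Q*aQ` acts as `Δ₁`: «Obviously we have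
Δ₁A₁ = G₁⁻¹A₁». [cite: Balaban1985Variational, (109)–(110) p.294] -/
theorem laplaceA_apply_of_mem {A₁ : E} (hQ : Q A₁ = 0) (hR : R (Dstar A₁) = 0) :
    laplaceA Δ₁ D R Dstar Q Qadj a A₁ = Δ₁ A₁ := by
  simp [laplaceA, LinearMap.add_apply, LinearMap.comp_apply, LinearMap.smul_apply, hR, hQ]

/-! ## §2 (105)–(107) -/

/-- **(105)** «⟨𝔓δA, J⟩ = ⟨δA, 𝔓*J⟩» (𝔓* = the adjoint of 𝔓 for ⟨·,·⟩). [cite: Balaban1985Variational, (105) p.293] -/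
theorem eq105 (hPadj : ∀ x y : E, ⟪P x, y⟫_ℝ = ⟪x, Padj y⟫_ℝ) (δA J : E) : ⟪P δA, J⟫_ℝ = ⟪δA, Padj J⟫_ℝ :=
  hPadj δA J

/-- **(106)** «⟨𝔓δA, Δ₁A₁⟩ = ⟨𝔓δA, (Δ₁ + DRD* + aQ*Q)A₁⟩ = ⟨δA, Δ₁A₁⟩» for `A₁` in the constraint space (109): the first equality
because `RD*A₁ = 0`, `Q𝔓δA = 0` (`inner_laplaceA_apply`), the second by the M-symmetry of the M-orthogonal projection 𝔓, `𝔓A₁ = A₁` and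
`MA₁ = Δ₁A₁`. [cite: Balaban1985Variational, (106) p.294] -/
theorem eq106 (hadj : ∀ (x : E) (y : F), ⟪x, Qadj y⟫_ℝ = ⟪Q x, y⟫_ℝ) (hPK : ∀ x : E, Q (P x) = 0 ∧ R (Dstar (P x)) = 0)
    (hPid : ∀ x : E, Q x = 0 → R (Dstar x) = 0 → P x = x)
    (hPsym : ∀ x y : E, ⟪P x, laplaceA Δ₁ D R Dstar Q Qadj a y⟫_ℝ = ⟪x, laplaceA Δ₁ D R Dstar Q Qadj a (P y)⟫_ℝ)
    {A₁ : E} (hQ : Q A₁ = 0) (hR : R (Dstar A₁) = 0) (δA : E) :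
    ⟪P δA, Δ₁ A₁⟫_ℝ = ⟪P δA, laplaceA Δ₁ D R Dstar Q Qadj a A₁⟫_ℝ ∧
      ⟪P δA, laplaceA Δ₁ D R Dstar Q Qadj a A₁⟫_ℝ = ⟪δA, Δ₁ A₁⟫_ℝ := by
  refine ⟨(inner_laplaceA_apply hadj a hR (hPK δA).1).symm, ?_⟩
  rw [hPsym, hPid A₁ hQ hR, laplaceA_apply_of_mem hQ hR]

/-- **(107)** «⟨𝔓δA, ((δ/δA′)V)(A₁ + H₁B)⟩ = ⟨δA, 𝔓*((δ/δA′)V)(A₁ + H₁B)⟩» (the functional derivative as the vector `W`).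
[cite: Balaban1985Variational, (107) p.294] -/
theorem eq107 (hPadj : ∀ x y : E, ⟪P x, y⟫_ℝ = ⟪x, Padj y⟫_ℝ) (δA W : E) : ⟪P δA, W⟫_ℝ = ⟪δA, Padj W⟫_ℝ :=
  hPadj δA W

/-- Bridge to `B11Eq101Translation`: when the derivative functional is `DV = ⟨·, W⟩` (Riesz vector `W`), (101) in the functional form of
that module is (101) in the vector form used here. [cite: Balaban1985Variational, (101) p.293] -/
theorem eq101_vector_iff (J A₁ W : E) :
    (∀ δ : E, Q δ = 0 → R (Dstar δ) = 0 → ⟪δ, J⟫_ℝ + ⟪δ, Δ₁ A₁⟫_ℝ + (fun x => ⟪x, W⟫_ℝ) δ = 0) ↔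
      ∀ δ : E, Q δ = 0 → R (Dstar δ) = 0 → ⟪δ, J⟫_ℝ + ⟪δ, Δ₁ A₁⟫_ℝ + ⟪δ, W⟫_ℝ = 0 :=
  Iff.rfl

/-! ## §3 (108)–(109) ⇔ (101)–(102) -/

/-- **(108)–(109) from (101)–(102)**: «By the definition of 𝔓 we obtain all the variations δA′ satisfying (102), if we take
δA′ = 𝔓δA for all variations δA, without any restrictions … Applying them in (101) and using the fact that now δA are arbitrary, we get
the equations 𝔓*J + Δ₁A₁ + 𝔓*((δ/δA′)V)(A₁ + H₁B) = 0. (108)» ((109) `QA₁ = 0, RD*A₁ = 0` is the hypothesis (102)).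
[cite: Balaban1985Variational, (108)–(109) p.294] -/
theorem eq108_of_eq101 (hadj : ∀ (x : E) (y : F), ⟪x, Qadj y⟫_ℝ = ⟪Q x, y⟫_ℝ)
    (hPK : ∀ x : E, Q (P x) = 0 ∧ R (Dstar (P x)) = 0) (hPid : ∀ x : E, Q x = 0 → R (Dstar x) = 0 → P x = x)
    (hPsym : ∀ x y : E, ⟪P x, laplaceA Δ₁ D R Dstar Q Qadj a y⟫_ℝ = ⟪x, laplaceA Δ₁ D R Dstar Q Qadj a (P y)⟫_ℝ)
    (hPadj : ∀ x y : E, ⟪P x, y⟫_ℝ = ⟪x, Padj y⟫_ℝ) {J A₁ W : E} (hQ : Q A₁ = 0) (hR : R (Dstar A₁) = 0)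
    (h101 : ∀ δ : E, Q δ = 0 → R (Dstar δ) = 0 → ⟪δ, J⟫_ℝ + ⟪δ, Δ₁ A₁⟫_ℝ + ⟪δ, W⟫_ℝ = 0) :
    Padj J + Δ₁ A₁ + Padj W = 0 := by
  apply ext_inner_left ℝ
  intro δA
  have h := h101 (P δA) (hPK δA).1 (hPK δA).2
  obtain ⟨h106a, h106b⟩ := eq106 hadj hPK hPid hPsym hQ hR δA
  rw [eq105 hPadj, h106a, h106b, eq107 hPadj] at h
  rw [inner_add_right, inner_add_right, inner_zero_right]
  exact h

/-- **«They are equivalent to Eqs. (101), (102)»**, the converse direction: (108) with `A₁` in the constraint space gives back (101)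
on the variations (102) (for `δA′` with `QδA′ = 0`, `RD*δA′ = 0`: `𝔓δA′ = δA′`, so `⟨δA′, 𝔓*J⟩ = ⟨δA′, J⟩` etc.).
[cite: Balaban1985Variational, (108)–(109) p.294] -/
theorem eq101_of_eq108 (hPid : ∀ x : E, Q x = 0 → R (Dstar x) = 0 → P x = x)
    (hPadj : ∀ x y : E, ⟪P x, y⟫_ℝ = ⟪x, Padj y⟫_ℝ) {J A₁ W : E} (h108 : Padj J + Δ₁ A₁ + Padj W = 0) :
    ∀ δ : E, Q δ = 0 → R (Dstar δ) = 0 → ⟪δ, J⟫_ℝ + ⟪δ, Δ₁ A₁⟫_ℝ + ⟪δ, W⟫_ℝ = 0 := by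
  intro δ hQδ hRδ
  have hJ : ⟪δ, J⟫_ℝ = ⟪δ, Padj J⟫_ℝ := by rw [← hPadj, hPid δ hQδ hRδ]
  have hW : ⟪δ, W⟫_ℝ = ⟪δ, Padj W⟫_ℝ := by rw [← hPadj, hPid δ hQδ hRδ]
  rw [hJ, hW, ← inner_add_right, ← inner_add_right, h108, inner_zero_right]

/-- (108) ⇔ (101), for `A₁` satisfying (109)/(102). [cite: Balaban1985Variational, (108)–(109) p.294] -/
theorem eq108_iff_eq101 (hadj : ∀ (x : E) (y : F), ⟪x, Qadj y⟫_ℝ = ⟪Q x, y⟫_ℝ)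
    (hPK : ∀ x : E, Q (P x) = 0 ∧ R (Dstar (P x)) = 0) (hPid : ∀ x : E, Q x = 0 → R (Dstar x) = 0 → P x = x)
    (hPsym : ∀ x y : E, ⟪P x, laplaceA Δ₁ D R Dstar Q Qadj a y⟫_ℝ = ⟪x, laplaceA Δ₁ D R Dstar Q Qadj a (P y)⟫_ℝ)
    (hPadj : ∀ x y : E, ⟪P x, y⟫_ℝ = ⟪x, Padj y⟫_ℝ) {J A₁ W : E} (hQ : Q A₁ = 0) (hR : R (Dstar A₁) = 0) :
    Padj J + Δ₁ A₁ + Padj W = 0 ↔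
      ∀ δ : E, Q δ = 0 → R (Dstar δ) = 0 → ⟪δ, J⟫_ℝ + ⟪δ, Δ₁ A₁⟫_ℝ + ⟪δ, W⟫_ℝ = 0 :=
  ⟨eq101_of_eq108 hPid hPadj, eq108_of_eq101 hadj hPK hPid hPsym hPadj hQ hR⟩

/-! ## §4 (110), the operator 𝔊 = G₁𝔓*, (111) -/

/-- **(110) from (108)**: «Obviously we have Δ₁A₁ = G₁⁻¹A₁ and Eq. (108) implies A₁ + G₁𝔓*J + G₁𝔓*((δ/δA′)V)(A₁ + H₁B) = 0. (110)»
— apply G₁ to (108) and use `G₁(Δ₁A₁) = G₁(G₁⁻¹A₁) = A₁` on the constraint space. [cite: Balaban1985Variational, (110) p.294] -/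
theorem eq110_of_eq108 (hGΔ : ∀ x : E, G₁ (laplaceA Δ₁ D R Dstar Q Qadj a x) = x) {J A₁ W : E} (hQ : Q A₁ = 0)
    (hR : R (Dstar A₁) = 0) (h108 : Padj J + Δ₁ A₁ + Padj W = 0) :
    A₁ + G₁ (Padj J) + G₁ (Padj W) = 0 := by
  have h := congrArg G₁ h108
  rw [map_add, map_add, map_zero, ← laplaceA_apply_of_mem (Δ₁ := Δ₁) (D := D) (R := R) (Dstar := Dstar) (Qadj := Qadj)
    (a := a) hQ hR, hGΔ] at h
  rw [← h]; abel

/-- The adjoint of an M-orthogonal projection: `𝔓*M = M𝔓` (from `⟨𝔓x, My⟩ = ⟨x, M𝔓y⟩` and `⟨𝔓x, z⟩ = ⟨x, 𝔓*z⟩`).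
[cite: Balaban1985Variational, (105) p.293, (106) p.294] -/
theorem padj_laplaceA (hPsym : ∀ x y : E, ⟪P x, laplaceA Δ₁ D R Dstar Q Qadj a y⟫_ℝ = ⟪x, laplaceA Δ₁ D R Dstar Q Qadj a (P y)⟫_ℝ)
    (hPadj : ∀ x y : E, ⟪P x, y⟫_ℝ = ⟪x, Padj y⟫_ℝ) (y : E) :
    Padj (laplaceA Δ₁ D R Dstar Q Qadj a y) = laplaceA Δ₁ D R Dstar Q Qadj a (P y) := by
  apply ext_inner_left ℝ
  intro x
  rw [← hPadj, hPsym]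

/-- **G₁𝔓* = 𝔓G₁** — the operator identity behind «In [5] we have proved that the operator G₁𝔓* is equal to the operator 𝔊 … satisfying
the equalities Q𝔊 = 0, RD*𝔊 = 0»: for G₁ a two-sided inverse of M = Δ₁ + DRD* + aQ*Q and 𝔓 M-orthogonal, `G₁𝔓*x = G₁𝔓*MG₁x = G₁M𝔓G₁x =
𝔓G₁x`.  (The identification of this operator with the FORMULA (3.148) of [5] is B9's row, not claimed.) [cite: Balaban1985Variational, (110)–(111) p.294] -/
theorem frakG_eq_proj_comp (hΔG : ∀ x : E, laplaceA Δ₁ D R Dstar Q Qadj a (G₁ x) = x)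
    (hGΔ : ∀ x : E, G₁ (laplaceA Δ₁ D R Dstar Q Qadj a x) = x)
    (hPsym : ∀ x y : E, ⟪P x, laplaceA Δ₁ D R Dstar Q Qadj a y⟫_ℝ = ⟪x, laplaceA Δ₁ D R Dstar Q Qadj a (P y)⟫_ℝ)
    (hPadj : ∀ x y : E, ⟪P x, y⟫_ℝ = ⟪x, Padj y⟫_ℝ) (x : E) :
    (G₁ ∘ₗ Padj) x = P (G₁ x) := by
  show G₁ (Padj x) = P (G₁ x)
  conv_lhs => rw [← hΔG x]
  rw [padj_laplaceA hPsym hPadj, hGΔ]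

/-- **«satisfying the equalities Q𝔊 = 0, RD*𝔊 = 0»**, PROVED for 𝔊 = G₁𝔓*: its range lies in the constraint space, since 𝔊 = 𝔓G₁
and 𝔓 maps into {QA = 0, RD*A = 0}. [cite: Balaban1985Variational, (111) p.294] -/
theorem frakG_mem (hΔG : ∀ x : E, laplaceA Δ₁ D R Dstar Q Qadj a (G₁ x) = x)
    (hGΔ : ∀ x : E, G₁ (laplaceA Δ₁ D R Dstar Q Qadj a x) = x) (hPK : ∀ x : E, Q (P x) = 0 ∧ R (Dstar (P x)) = 0)
    (hPsym : ∀ x y : E, ⟪P x, laplaceA Δ₁ D R Dstar Q Qadj a y⟫_ℝ = ⟪x, laplaceA Δ₁ D R Dstar Q Qadj a (P y)⟫_ℝ)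
    (hPadj : ∀ x y : E, ⟪P x, y⟫_ℝ = ⟪x, Padj y⟫_ℝ) (x : E) :
    Q ((G₁ ∘ₗ Padj) x) = 0 ∧ R (Dstar ((G₁ ∘ₗ Padj) x)) = 0 := by
  rw [frakG_eq_proj_comp hΔG hGΔ hPsym hPadj]
  exact hPK (G₁ x)

/-- **(111) ⇔ (110)**: «Let us rewrite this equation using the operator 𝔊, A₁ + 𝔊J + 𝔊((δ/δA′)V)(A₁ + H₁B) = 0. (111)» — with 𝔊 = G₁𝔓*
the two displays are the same equation. [cite: Balaban1985Variational, (111) p.294] -/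
theorem eq111_iff_eq110 (J A₁ W : E) :
    A₁ + (G₁ ∘ₗ Padj) J + (G₁ ∘ₗ Padj) W = 0 ↔ A₁ + G₁ (Padj J) + G₁ (Padj W) = 0 :=
  Iff.rfl

/-- **«Thus any solution of (110) satisfies automatically Eq. (108), (109)»**: from (110) `A₁ = −𝔊J − 𝔊W` lies in the constraint space
((109), by `frakG_mem`), and applying M = G₁⁻¹ to (110) gives `MA₁ + 𝔓*J + 𝔓*W = 0` with `MA₁ = Δ₁A₁` there ((108)).
[cite: Balaban1985Variational, (108)–(110) p.294] -/
theorem eq108_109_of_eq110 (hΔG : ∀ x : E, laplaceA Δ₁ D R Dstar Q Qadj a (G₁ x) = x)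
    (hGΔ : ∀ x : E, G₁ (laplaceA Δ₁ D R Dstar Q Qadj a x) = x) (hPK : ∀ x : E, Q (P x) = 0 ∧ R (Dstar (P x)) = 0)
    (hPsym : ∀ x y : E, ⟪P x, laplaceA Δ₁ D R Dstar Q Qadj a y⟫_ℝ = ⟪x, laplaceA Δ₁ D R Dstar Q Qadj a (P y)⟫_ℝ)
    (hPadj : ∀ x y : E, ⟪P x, y⟫_ℝ = ⟪x, Padj y⟫_ℝ) {J A₁ W : E} (h110 : A₁ + G₁ (Padj J) + G₁ (Padj W) = 0) :
    (Q A₁ = 0 ∧ R (Dstar A₁) = 0) ∧ Padj J + Δ₁ A₁ + Padj W = 0 := by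
  -- A₁ = −𝔊J − 𝔊W lies in the constraint space
  have hA₁ : A₁ = -((G₁ ∘ₗ Padj) J) - (G₁ ∘ₗ Padj) W := by
    rw [← sub_eq_zero]
    have : A₁ - (-((G₁ ∘ₗ Padj) J) - (G₁ ∘ₗ Padj) W) = A₁ + G₁ (Padj J) + G₁ (Padj W) := by
      simp only [LinearMap.comp_apply]; abel
    rw [this, h110]
  obtain ⟨hJQ, hJR⟩ := frakG_mem hΔG hGΔ hPK hPsym hPadj J
  obtain ⟨hWQ, hWR⟩ := frakG_mem hΔG hGΔ hPK hPsym hPadj W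
  have hQ : Q A₁ = 0 := by rw [hA₁, map_sub, map_neg, hJQ, hWQ]; simp
  have hR : R (Dstar A₁) = 0 := by rw [hA₁, map_sub, map_neg, map_sub, map_neg, hJR, hWR]; simp
  refine ⟨⟨hQ, hR⟩, ?_⟩
  -- apply M to (110)
  have h := congrArg (laplaceA Δ₁ D R Dstar Q Qadj a) h110
  rw [map_add, map_add, map_zero, hΔG, hΔG, laplaceA_apply_of_mem hQ hR] at h
  calc Padj J + Δ₁ A₁ + Padj W = Δ₁ A₁ + Padj J + Padj W := by abel
    _ = 0 := h

/-- **Summary of the reduction (101)–(102) ⇔ (111)** (vector form of the derivative): under the dictionary's hypotheses on 𝔓, 𝔓*, G₁,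
`A₁` solves (111) iff `A₁` lies in the constraint space (102)/(109) and the translated variational equation (101) holds for all
variations (102).  (⇒: «any solution of (110) satisfies automatically (108), (109)» and «They are equivalent to Eqs. (101), (102)»;
⇐: (105)–(110).) [cite: Balaban1985Variational, (101)–(111) pp.293–294] -/
theorem eq111_iff_eq101 (hadj : ∀ (x : E) (y : F), ⟪x, Qadj y⟫_ℝ = ⟪Q x, y⟫_ℝ)
    (hΔG : ∀ x : E, laplaceA Δ₁ D R Dstar Q Qadj a (G₁ x) = x)
    (hGΔ : ∀ x : E, G₁ (laplaceA Δ₁ D R Dstar Q Qadj a x) = x) (hPK : ∀ x : E, Q (P x) = 0 ∧ R (Dstar (P x)) = 0)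
    (hPid : ∀ x : E, Q x = 0 → R (Dstar x) = 0 → P x = x)
    (hPsym : ∀ x y : E, ⟪P x, laplaceA Δ₁ D R Dstar Q Qadj a y⟫_ℝ = ⟪x, laplaceA Δ₁ D R Dstar Q Qadj a (P y)⟫_ℝ)
    (hPadj : ∀ x y : E, ⟪P x, y⟫_ℝ = ⟪x, Padj y⟫_ℝ) (J A₁ W : E) :
    A₁ + (G₁ ∘ₗ Padj) J + (G₁ ∘ₗ Padj) W = 0 ↔
      (Q A₁ = 0 ∧ R (Dstar A₁) = 0) ∧
        ∀ δ : E, Q δ = 0 → R (Dstar δ) = 0 → ⟪δ, J⟫_ℝ + ⟪δ, Δ₁ A₁⟫_ℝ + ⟪δ, W⟫_ℝ = 0 := by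
  constructor
  · intro h111
    obtain ⟨hK, h108⟩ := eq108_109_of_eq110 hΔG hGΔ hPK hPsym hPadj ((eq111_iff_eq110 J A₁ W).1 h111)
    exact ⟨hK, eq101_of_eq108 hPid hPadj h108⟩
  · rintro ⟨⟨hQ, hR⟩, h101⟩
    exact (eq111_iff_eq110 J A₁ W).2
      (eq110_of_eq108 hGΔ hQ hR (eq108_of_eq101 hadj hPK hPid hPsym hPadj hQ hR h101))

end Literature.MathematicalPhysics.QuantumFieldTheory.Balaban1983to89.B11Eq108Reduction
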